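import Literature.NumberTheory.LFunctions.PatelYangDualSum
import Literature.NumberTheory.LFunctions.ExplicitAProcess
import HarnessLib

/-!
# Patel–Yang's Lemma 3.4: the `A`-process assembly of a top-range block (monomial inputs)

Topic `Literature/NumberTheory/LFunctions`. Auxiliary PROVED inequalities turning the block bound
`Literature.NumberTheory.LFunctions.VdC.diffSum_block_le` into monomials in `a`, `Kr` (Patel–Yang
2024, proof of Lemma 3.4, (3.15)–(3.21)): the length of the dual range
`β - α ≤ 2(h-1)Kr/a²` ((3.15), "N_bound"), the logarithmic error term
`log(2 + x) ≤ log 2 + 3 + 3(x/2)^{1/3}` (replacing `log(2+x) ≤ log 2 + 0.893x^{1/3}`), and the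
order-`5` right-hand side `yangKRHS η H 5 N λ = A₅ H^{1/8} N λ^{1/30} + B₅ N^{7/8} λ^{-1/30}`.

## References

* D. Patel, A. Yang, *An explicit sub-Weyl bound for `ζ(1/2 + it)`*, J. Number Theory 262 (2024),
  proof of Lemma 3.4. [cite: PatelYang2024, Lemma 3.4]
-/

noncomputable section

open Real Set

namespace Literature.NumberTheory.LFunctions
namespace VdC

/-- `g_r'(y) = Kr/(y(y+r))`. [folklore] -/
theorem dphase_one_eq_Kr_div {t r y : ℝ} (hy : 0 < y) (hr : 0 < r) :
    dphase t r 1 y = (t / (2 * π)) * r / (y * (y + r)) := by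
  have hyr : 0 < y + r := by linarith
  rw [dphase_one, inv_sub_inv_add_eq hy hyr]; ring

/-- **The length of the dual range** (Patel–Yang (3.15)): for `0 < a`, `a + r ≤ L ≤ ha`,
`β - α = g_r'(a) - g_r'(L-r) ≤ 2(h-1)Kr/a²`. [cite: PatelYang2024, Lemma 3.4] -/
theorem dualRange_le {t r a L h : ℝ} (ht : 0 < t) (hr : 0 < r) (ha : 0 < a) (harL : a + r ≤ L)
    (hL : L ≤ h * a) :
    dphase t r 1 a - dphase t r 1 (L - r) ≤ 2 * (h - 1) * ((t / (2 * π)) * r) / a ^ 2 := by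
  have hK : 0 < t / (2 * π) := by positivity
  have hLr : 0 < L - r := by linarith
  have hL0 : 0 < L := by linarith
  rw [dphase_one_eq_Kr_div ha hr, dphase_one_eq_Kr_div hLr hr, sub_add_cancel]
  set ρ : ℝ := (t / (2 * π)) * r with hρ
  have hρ0 : 0 < ρ := by positivity
  -- `ρ/(a(a+r)) - ρ/((L-r)L) = ρ (L+a)(L-a-r)/(a(a+r)(L-r)L)`
  have e1 : ρ / (a * (a + r)) - ρ / ((L - r) * L)
      = ρ * ((L + a) * (L - a - r)) / (a * (a + r) * ((L - r) * L)) := by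
    field_simp; ring
  rw [e1, div_le_div_iff₀ (by positivity) (by positivity)]
  -- `ρ (L+a)(L-a-r) a² ≤ 2(h-1)ρ · a(a+r)(L-r)L`
  have h1 : L - a - r ≤ (h - 1) * a := by linarith
  have h2 : 0 ≤ L - a - r := by linarith
  have h3 : L + a ≤ 2 * L := by linarith
  have h4 : a * a ≤ (a + r) * (L - r) := by nlinarith
  calc ρ * ((L + a) * (L - a - r)) * a ^ 2
      ≤ ρ * ((2 * L) * ((h - 1) * a)) * a ^ 2 := by gcongr
    _ = 2 * (h - 1) * ρ * (L * a) * (a * a) := by ring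
    _ ≤ 2 * (h - 1) * ρ * (L * a) * ((a + r) * (L - r)) := by
        have : 0 ≤ 2 * (h - 1) * ρ * (L * a) := by
          have : 1 ≤ h := by nlinarith
          positivity
        exact mul_le_mul_of_nonneg_left h4 this
    _ = 2 * (h - 1) * ρ * (a * (a + r) * ((L - r) * L)) := by ring

/-- **The logarithmic error term**: `log(2 + x) ≤ log 2 + 3 + 3(x/2)^{1/3}` for `x ≥ 0`
(from `log y ≤ 3y^{1/3}` and the subadditivity of the cube root). [folklore] -/
theorem log_two_add_le {x : ℝ} (hx : 0 ≤ x) :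
    Real.log (2 + x) ≤ Real.log 2 + 3 + 3 * (x / 2) ^ (1 / 3 : ℝ) := by
  have h1 : Real.log (2 + x) = Real.log 2 + Real.log (1 + x / 2) := by
    rw [← Real.log_mul (by norm_num) (by positivity)]; congr 1; ring
  rw [h1]
  suffices h : Real.log (1 + x / 2) ≤ 3 + 3 * (x / 2) ^ (1 / 3 : ℝ) by linarith
  have h2 : Real.log (1 + x / 2) ≤ (1 + x / 2) ^ (1 / 3 : ℝ) / (1 / 3 : ℝ) :=
    Real.log_le_rpow_div (by positivity) (by norm_num)
  have h3 : (1 + x / 2) ^ (1 / 3 : ℝ) ≤ (1 : ℝ) ^ (1 / 3 : ℝ) + (x / 2) ^ (1 / 3 : ℝ) :=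
    Real.rpow_add_le_add_rpow zero_le_one (by positivity) (by norm_num) (by norm_num)
  rw [Real.one_rpow] at h3
  calc Real.log (1 + x / 2) ≤ (1 + x / 2) ^ (1 / 3 : ℝ) / (1 / 3 : ℝ) := h2
    _ = 3 * (1 + x / 2) ^ (1 / 3 : ℝ) := by ring
    _ ≤ 3 * (1 + (x / 2) ^ (1 / 3 : ℝ)) := by linarith
    _ = (3 + 3 * (x / 2) ^ (1 / 3 : ℝ) : ℝ) := by ring

/-- The order-`5` right-hand side of Yang's test: `K = 16`, exponents `2/K = 1/8`,
`1/(2K-2) = 1/30`, `1 - 2/K = 7/8`. [cite: PatelYang2024, (3.13)] -/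
theorem yangKRHS_five (η H N lam : ℝ) :
    yangKRHS η H 5 N lam = yangA η H 5 * H ^ (1 / 8 : ℝ) * N * lam ^ (1 / 30 : ℝ)
      + yangB η 5 * N ^ (7 / 8 : ℝ) * lam ^ (-(1 / 30 : ℝ)) := by
  unfold yangKRHS
  have hJ : yangJ 5 = 16 := by rw [yangJ]; norm_num
  rw [hJ]
  norm_num

/-! ### Root variables: `a = U⁶⁰`, `Kr = V¹²⁰` -/

/-- `(U^m)^s = U^k` when `m s = k`. [folklore] -/
theorem rpow_pow_natCast' {U : ℝ} (hU : 0 ≤ U) (m k : ℕ) {s : ℝ} (h : (m : ℝ) * s = k) :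
    (U ^ m) ^ s = U ^ k := by
  rw [← Real.rpow_natCast U m, ← Real.rpow_mul hU, h, Real.rpow_natCast]

/-- `(U^m)^s = (U^k)⁻¹` when `m s = -k`. [folklore] -/
theorem rpow_pow_neg' {U : ℝ} (hU : 0 ≤ U) (m k : ℕ) {s : ℝ} (h : (m : ℝ) * s = -k) :
    (U ^ m) ^ s = (U ^ k)⁻¹ := by
  rw [← Real.rpow_natCast U m, ← Real.rpow_mul hU, h, Real.rpow_neg hU, Real.rpow_natCast]

/-- `(c · U^m / V^n)^s = c^s · U^{ms} / V^{ns}` for integral `ms, ns`. [folklore] -/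
theorem rpow_monomial {c U V s : ℝ} (hc : 0 ≤ c) (hU : 0 ≤ U) (hV : 0 ≤ V) (m n k l : ℕ)
    (hm : (m : ℝ) * s = k) (hn : (n : ℝ) * s = l) :
    (c * U ^ m / V ^ n) ^ s = c ^ s * U ^ k / V ^ l := by
  rw [Real.div_rpow (by positivity) (by positivity), Real.mul_rpow hc (by positivity),
    rpow_pow_natCast' hU m k hm, rpow_pow_natCast' hV n l hn]

set_option maxHeartbeats 1600000 in
/-- **The differenced block sum in monomial form** (Patel–Yang (3.16)–(3.21) with our constants):
for `t > 0`, `1 < h`, `η > 0`, integers `1 ≤ a`, `L ≤ ha` and `r ≥ 1`, with `ρ = (t/2π) r`,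
`‖∑_{a<n≤L-r} e(f(n+r) - f(n))‖ ≤ c₀ a^{3/2}ρ^{-1/2} + c₁ ρ^{11/30}a^{-1/5} + c₂ ρ^{61/120}a^{-11/20}
  + e₀ + e₁ ρ^{1/3}a^{-2/3} + e₂ ρ^{2/5}a^{-2/5}` with the displayed constants.
[cite: PatelYang2024, Lemma 3.4] -/
theorem diffSum_block_monomial_le {t h η : ℝ} (ht : 0 < t) (hh1 : 1 < h) (hη : 0 < η)
    {a L : ℤ} {r : ℕ} (ha : 1 ≤ a) (hr : 1 ≤ r) (hL : (L : ℝ) ≤ h * a) :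
    ‖∑ n ∈ Finset.Ioc a (L - r), e (phaseD t 0 ((n + r : ℤ)) - phaseD t 0 n)‖
      ≤ (3 + 50 * h ^ 8) / Real.sqrt 2 * (h * Real.sqrt h)
            * (a : ℝ) ^ (3 / 2 : ℝ) * ((t / (2 * π)) * r) ^ (-(1 / 2 : ℝ))
        + 3 / Real.sqrt 2 * (h * Real.sqrt h) * yangA η (h ^ 13) 5 * (h ^ 13) ^ (1 / 8 : ℝ)
            * (2 * (h - 1)) * (105 / 16 / h ^ 2) ^ (1 / 30 : ℝ)
            * ((t / (2 * π)) * r) ^ (11 / 30 : ℝ) * (a : ℝ) ^ (-(1 / 5 : ℝ))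
        + 3 / Real.sqrt 2 * (h * Real.sqrt h) * yangB η 5 * (2 * (h - 1)) ^ (7 / 8 : ℝ)
            * ((105 / 16 / h ^ 2) ^ (1 / 30 : ℝ))⁻¹
            * ((t / (2 * π)) * r) ^ (61 / 120 : ℝ) * (a : ℝ) ^ (-(11 / 20 : ℝ))
        + 50 * h ^ 8 * (Real.log 2 + 3)
        + 50 * h ^ 8 * 3 * ((h - 1) / h ^ 3) ^ (1 / 3 : ℝ)
            * ((t / (2 * π)) * r) ^ (1 / 3 : ℝ) * (a : ℝ) ^ (-(2 / 3 : ℝ))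
        + 50 * h ^ 8 * (h - 1) * (12 / h ^ 7) ^ (1 / 5 : ℝ)
            * ((t / (2 * π)) * r) ^ (2 / 5 : ℝ) * (a : ℝ) ^ (-(2 / 5 : ℝ)) := by
  have hπ := Real.pi_pos
  have hh : 1 ≤ h := hh1.le
  have hh0 : 0 < h := by linarith
  have hK : 0 < t / (2 * π) := by positivity
  have ha0 : (0 : ℝ) < a := by exact_mod_cast (show (0 : ℤ) < a by omega)
  have hr0 : (0 : ℝ) < r := by exact_mod_cast (show 0 < r by omega)
  have hρ0 : 0 < (t / (2 * π)) * r := by positivity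
  have hA5 : 0 < yangA η (h ^ 13) 5 := yangA_pos hη (one_le_pow₀ hh) 5 (by norm_num)
  have hB5 : 0 < yangB η 5 := yangB_pos hη 5 (by norm_num)
  have hsh : 0 < Real.sqrt h := Real.sqrt_pos.2 hh0
  have hs2 : 0 < Real.sqrt 2 := Real.sqrt_pos.2 (by norm_num)
  -- the root variables
  obtain ⟨U, hU0, hUa⟩ : ∃ U : ℝ, 0 < U ∧ U ^ 60 = (a : ℝ) :=
    ⟨(a : ℝ) ^ (1 / 60 : ℝ), Real.rpow_pos_of_pos ha0 _, by
      rw [← Real.rpow_natCast, ← Real.rpow_mul ha0.le]; norm_num⟩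
  obtain ⟨V, hV0, hVρ⟩ : ∃ V : ℝ, 0 < V ∧ V ^ 120 = (t / (2 * π)) * r :=
    ⟨((t / (2 * π)) * r) ^ (1 / 120 : ℝ), Real.rpow_pos_of_pos hρ0 _, by
      rw [← Real.rpow_natCast, ← Real.rpow_mul hρ0.le]; norm_num⟩
  -- the target monomials in root form
  have m1 : (a : ℝ) ^ (3 / 2 : ℝ) * ((t / (2 * π)) * r) ^ (-(1 / 2 : ℝ)) = U ^ 90 / V ^ 60 := by
    rw [← hUa, ← hVρ, rpow_pow_natCast' hU0.le 60 90 (by norm_num),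
      rpow_pow_neg' hV0.le 120 60 (by norm_num), div_eq_mul_inv]
  have m2 : ((t / (2 * π)) * r) ^ (11 / 30 : ℝ) * (a : ℝ) ^ (-(1 / 5 : ℝ)) = V ^ 44 / U ^ 12 := by
    rw [← hUa, ← hVρ, rpow_pow_natCast' hV0.le 120 44 (by norm_num),
      rpow_pow_neg' hU0.le 60 12 (by norm_num), div_eq_mul_inv]
  have m3 : ((t / (2 * π)) * r) ^ (61 / 120 : ℝ) * (a : ℝ) ^ (-(11 / 20 : ℝ)) = V ^ 61 / U ^ 33 := by
    rw [← hUa, ← hVρ, rpow_pow_natCast' hV0.le 120 61 (by norm_num),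
      rpow_pow_neg' hU0.le 60 33 (by norm_num), div_eq_mul_inv]
  have m4 : ((t / (2 * π)) * r) ^ (1 / 3 : ℝ) * (a : ℝ) ^ (-(2 / 3 : ℝ)) = V ^ 40 / U ^ 40 := by
    rw [← hUa, ← hVρ, rpow_pow_natCast' hV0.le 120 40 (by norm_num),
      rpow_pow_neg' hU0.le 60 40 (by norm_num), div_eq_mul_inv]
  have m5 : ((t / (2 * π)) * r) ^ (2 / 5 : ℝ) * (a : ℝ) ^ (-(2 / 5 : ℝ)) = V ^ 48 / U ^ 24 := by
    rw [← hUa, ← hVρ, rpow_pow_natCast' hV0.le 120 48 (by norm_num),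
      rpow_pow_neg' hU0.le 60 24 (by norm_num), div_eq_mul_inv]
  -- the constants
  set C₀ : ℝ := (3 + 50 * h ^ 8) / Real.sqrt 2 * (h * Real.sqrt h) with hC₀
  set C₁ : ℝ := 3 / Real.sqrt 2 * (h * Real.sqrt h) * yangA η (h ^ 13) 5 * (h ^ 13) ^ (1 / 8 : ℝ)
    * (2 * (h - 1)) * (105 / 16 / h ^ 2) ^ (1 / 30 : ℝ) with hC₁
  set C₂ : ℝ := 3 / Real.sqrt 2 * (h * Real.sqrt h) * yangB η 5 * (2 * (h - 1)) ^ (7 / 8 : ℝ)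
    * ((105 / 16 / h ^ 2) ^ (1 / 30 : ℝ))⁻¹ with hC₂
  set E₀ : ℝ := 50 * h ^ 8 * (Real.log 2 + 3) with hE₀
  set E₁ : ℝ := 50 * h ^ 8 * 3 * ((h - 1) / h ^ 3) ^ (1 / 3 : ℝ) with hE₁
  set E₂ : ℝ := 50 * h ^ 8 * (h - 1) * (12 / h ^ 7) ^ (1 / 5 : ℝ) with hE₂
  have hC₀0 : 0 ≤ C₀ := by positivity
  have hC₁0 : 0 ≤ C₁ := by
    have : 0 ≤ h - 1 := by linarith
    positivity
  have hC₂0 : 0 ≤ C₂ := by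
    have : 0 ≤ h - 1 := by linarith
    positivity
  have hE₀0 : 0 ≤ E₀ := by
    have : 0 < Real.log 2 := Real.log_pos (by norm_num)
    positivity
  have hE₁0 : 0 ≤ E₁ := by
    have : 0 ≤ (h - 1) / h ^ 3 := div_nonneg (by linarith) (by positivity)
    positivity
  have hE₂0 : 0 ≤ E₂ := by
    have : 0 ≤ h - 1 := by linarith
    positivity
  -- rewrite the goal in root form
  have goal_eq : C₀ * (a : ℝ) ^ (3 / 2 : ℝ) * ((t / (2 * π)) * r) ^ (-(1 / 2 : ℝ))
        + C₁ * ((t / (2 * π)) * r) ^ (11 / 30 : ℝ) * (a : ℝ) ^ (-(1 / 5 : ℝ))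
        + C₂ * ((t / (2 * π)) * r) ^ (61 / 120 : ℝ) * (a : ℝ) ^ (-(11 / 20 : ℝ))
        + E₀ + E₁ * ((t / (2 * π)) * r) ^ (1 / 3 : ℝ) * (a : ℝ) ^ (-(2 / 3 : ℝ))
        + E₂ * ((t / (2 * π)) * r) ^ (2 / 5 : ℝ) * (a : ℝ) ^ (-(2 / 5 : ℝ))
      = C₀ * (U ^ 90 / V ^ 60) + C₁ * (V ^ 44 / U ^ 12) + C₂ * (V ^ 61 / U ^ 33) + E₀
        + E₁ * (V ^ 40 / U ^ 40) + E₂ * (V ^ 48 / U ^ 24) := by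
    rw [← m1, ← m2, ← m3, ← m4, ← m5]; ring
  rw [goal_eq]
  have hRHS0 : 0 ≤ C₀ * (U ^ 90 / V ^ 60) + C₁ * (V ^ 44 / U ^ 12) + C₂ * (V ^ 61 / U ^ 33) + E₀
      + E₁ * (V ^ 40 / U ^ 40) + E₂ * (V ^ 48 / U ^ 24) := by positivity
  -- the empty case
  rcases le_or_gt (a + r) L with harL | hlt
  swap
  · rw [Finset.Ioc_eq_empty (by omega), Finset.sum_empty, norm_zero]; exact hRHS0
  -- the block bound
  have hB := diffSum_block_le (η := η) ht hh hη ha hr harL hL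
  refine hB.trans ?_
  have harL' : (a : ℝ) + r ≤ L := by exact_mod_cast harL
  -- (ii) `(√λ₂)⁻¹ = h√h U⁹⁰/(√2 V⁶⁰)`
  have e2 : Real.sqrt 2 ^ 2 = 2 := Real.sq_sqrt (by norm_num)
  have eh : Real.sqrt h ^ 2 = h := Real.sq_sqrt hh0.le
  have hlam2 : 2 * (t / (2 * π)) * r / (h * a) ^ 3 = (Real.sqrt 2 * V ^ 60 / (h * Real.sqrt h * U ^ 90)) ^ 2 := by
    rw [div_pow, show (Real.sqrt 2 * V ^ 60) ^ 2 = 2 * V ^ 120 by rw [mul_pow, e2]; ring,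
      show (h * Real.sqrt h * U ^ 90) ^ 2 = h ^ 3 * U ^ 180 by rw [mul_pow, mul_pow, eh]; ring,
      ← hUa, mul_assoc 2, ← hVρ]
    ring
  have hsq : Real.sqrt (2 * (t / (2 * π)) * r / (h * a) ^ 3) = Real.sqrt 2 * V ^ 60 / (h * Real.sqrt h * U ^ 90) := by
    rw [hlam2, Real.sqrt_sq (by positivity)]
  have hisq : (Real.sqrt (2 * (t / (2 * π)) * r / (h * a) ^ 3))⁻¹ = h * Real.sqrt h * U ^ 90 / (Real.sqrt 2 * V ^ 60) := by
    rw [hsq, inv_div]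
  -- (iii) the order-5 right-hand side
  have hl5 : 105 / 16 * (a : ℝ) ^ 9 / (h ^ 2 * (t / (2 * π)) ^ 4 * (r : ℝ) ^ 4)
      = (105 / 16 / h ^ 2) * U ^ 540 / V ^ 480 := by
    rw [← hUa, show h ^ 2 * (t / (2 * π)) ^ 4 * (r : ℝ) ^ 4 = h ^ 2 * ((t / (2 * π)) * r) ^ 4 by ring, ← hVρ]
    field_simp
  have hl50 : 0 < (105 / 16 / h ^ 2) * U ^ 540 / V ^ 480 := by positivity
  have hc105 : 0 ≤ (105 : ℝ) / 16 / h ^ 2 := by positivity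
  have hl5a : ((105 / 16 / h ^ 2) * U ^ 540 / V ^ 480) ^ (1 / 30 : ℝ)
      = (105 / 16 / h ^ 2) ^ (1 / 30 : ℝ) * U ^ 18 / V ^ 16 :=
    rpow_monomial hc105 hU0.le hV0.le 540 480 18 16 (by norm_num) (by norm_num)
  have hl5b : ((105 / 16 / h ^ 2) * U ^ 540 / V ^ 480) ^ (-(1 / 30 : ℝ))
      = ((105 / 16 / h ^ 2) ^ (1 / 30 : ℝ))⁻¹ * V ^ 16 / U ^ 18 := by
    rw [Real.rpow_neg hl50.le, hl5a]; field_simp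
  have hdual := dualRange_le ht hr0 ha0 harL' hL
  have hdual0 : 0 ≤ dphase t r 1 a - dphase t r 1 ((L : ℝ) - r) := by
    have hbr : (a : ℝ) ≤ (L : ℝ) - r := by linarith
    rcases hbr.lt_or_eq with hlt | heq
    · linarith [dphase_one_strictAnti ht hr0 ha0 hlt]
    · rw [heq]; linarith
  have hNρ : 2 * (h - 1) * ((t / (2 * π)) * r) / (a : ℝ) ^ 2 = (2 * (h - 1)) * V ^ 120 / U ^ 120 := by
    rw [← hUa, ← hVρ]; ring
  have hY : yangKRHS η (h ^ 13) 5 (dphase t r 1 a - dphase t r 1 ((L : ℝ) - r))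
        (105 / 16 * (a : ℝ) ^ 9 / (h ^ 2 * (t / (2 * π)) ^ 4 * (r : ℝ) ^ 4))
      ≤ yangA η (h ^ 13) 5 * (h ^ 13) ^ (1 / 8 : ℝ) * ((2 * (h - 1)) * V ^ 120 / U ^ 120)
          * ((105 / 16 / h ^ 2) ^ (1 / 30 : ℝ) * U ^ 18 / V ^ 16)
        + yangB η 5 * ((2 * (h - 1)) ^ (7 / 8 : ℝ) * V ^ 105 / U ^ 105)
          * (((105 / 16 / h ^ 2) ^ (1 / 30 : ℝ))⁻¹ * V ^ 16 / U ^ 18) := by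
    have hmono := yangKRHS_mono hη (one_le_pow₀ hh : 1 ≤ h ^ 13) (by norm_num : 3 ≤ 5) hdual0 hdual
      (by positivity : 0 < 105 / 16 * (a : ℝ) ^ 9 / (h ^ 2 * (t / (2 * π)) ^ 4 * (r : ℝ) ^ 4))
    refine hmono.trans (le_of_eq ?_)
    rw [yangKRHS_five, hl5, hl5a, hl5b, hNρ,
      rpow_monomial (by linarith : (0:ℝ) ≤ 2 * (h - 1)) hV0.le hU0.le 120 120 105 105 (by norm_num) (by norm_num)]
  -- (iv) the logarithm
  have hN : ((L : ℝ) - r) - a ≤ (h - 1) * a := by linarith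
  have hN0 : 0 ≤ ((L : ℝ) - r) - a := by linarith
  have hW0 : 0 ≤ (h - 1) / h ^ 3 := div_nonneg (by linarith) (by positivity)
  have hx : (((L : ℝ) - r) - a) * (2 * (t / (2 * π)) * r / (h * a) ^ 3)
      ≤ 2 * ((h - 1) / h ^ 3 * V ^ 120 / U ^ 120) := by
    calc (((L : ℝ) - r) - a) * (2 * (t / (2 * π)) * r / (h * a) ^ 3)
        ≤ ((h - 1) * a) * (2 * (t / (2 * π)) * r / (h * a) ^ 3) :=
          mul_le_mul_of_nonneg_right hN (by positivity)
      _ = 2 * ((h - 1) / h ^ 3 * V ^ 120 / U ^ 120) := by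
          rw [← hUa, mul_assoc 2 (t / (2 * π)), ← hVρ]; field_simp
  have hW13 : ((h - 1) / h ^ 3 * V ^ 120 / U ^ 120) ^ (1 / 3 : ℝ)
      = ((h - 1) / h ^ 3) ^ (1 / 3 : ℝ) * V ^ 40 / U ^ 40 :=
    rpow_monomial hW0 hV0.le hU0.le 120 120 40 40 (by norm_num) (by norm_num)
  have hlog : Real.log ((((L : ℝ) - r) - a) * (2 * (t / (2 * π)) * r / (h * a) ^ 3) + 2)
      ≤ Real.log 2 + 3 + 3 * (((h - 1) / h ^ 3) ^ (1 / 3 : ℝ) * V ^ 40 / U ^ 40) := by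
    have hx0 : 0 ≤ (((L : ℝ) - r) - a) * (2 * (t / (2 * π)) * r / (h * a) ^ 3) := by positivity
    have hWV : 0 ≤ (h - 1) / h ^ 3 * V ^ 120 / U ^ 120 := by positivity
    calc Real.log ((((L : ℝ) - r) - a) * (2 * (t / (2 * π)) * r / (h * a) ^ 3) + 2)
        ≤ Real.log (2 + 2 * ((h - 1) / h ^ 3 * V ^ 120 / U ^ 120)) :=
          Real.log_le_log (by positivity) (by linarith)
      _ ≤ Real.log 2 + 3 + 3 * ((2 * ((h - 1) / h ^ 3 * V ^ 120 / U ^ 120)) / 2) ^ (1 / 3 : ℝ) :=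
          log_two_add_le (by positivity)
      _ = Real.log 2 + 3 + 3 * (((h - 1) / h ^ 3) ^ (1 / 3 : ℝ) * V ^ 40 / U ^ 40) := by
          rw [mul_div_cancel_left₀ _ (two_ne_zero), hW13]
  -- (v) the `(λ₂λ₃)^{1/5}` term
  have hll : (2 * (t / (2 * π)) * r / (h * a) ^ 3) * (6 * (t / (2 * π)) * r / (h ^ 4 * (a : ℝ) ^ 4))
      = (12 / h ^ 7) * V ^ 240 / U ^ 420 := by
    rw [← hUa, mul_assoc 2 (t / (2 * π)), mul_assoc 6 (t / (2 * π)), hVρ.symm]; field_simp; ring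
  have h15 : ((12 / h ^ 7) * V ^ 240 / U ^ 420) ^ (1 / 5 : ℝ) = (12 / h ^ 7) ^ (1 / 5 : ℝ) * V ^ 48 / U ^ 84 :=
    rpow_monomial (by positivity) hV0.le hU0.le 240 420 48 84 (by norm_num) (by norm_num)
  have hNE : (((L : ℝ) - r) - a) * ((2 * (t / (2 * π)) * r / (h * a) ^ 3)
        * (6 * (t / (2 * π)) * r / (h ^ 4 * (a : ℝ) ^ 4))) ^ (1 / 5 : ℝ)
      ≤ ((h - 1) * U ^ 60) * ((12 / h ^ 7) ^ (1 / 5 : ℝ) * V ^ 48 / U ^ 84) := by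
    rw [hll, h15]
    refine mul_le_mul_of_nonneg_right ?_ (by positivity)
    rw [hUa]; exact hN
  -- (vi) assembly
  have hI0 : 0 ≤ h * Real.sqrt h * U ^ 90 / (Real.sqrt 2 * V ^ 60) := by positivity
  calc 3 * (Real.sqrt (2 * (t / (2 * π)) * r / (h * a) ^ 3))⁻¹
          * (1 + yangKRHS η (h ^ 13) 5 (dphase t r 1 a - dphase t r 1 ((L : ℝ) - r))
            (105 / 16 * (a : ℝ) ^ 9 / (h ^ 2 * (t / (2 * π)) ^ 4 * (r : ℝ) ^ 4)))
        + 50 * (h ^ 4) ^ 2 * (1 / Real.sqrt (2 * (t / (2 * π)) * r / (h * a) ^ 3)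
          + Real.log ((((L : ℝ) - r) - a) * (2 * (t / (2 * π)) * r / (h * a) ^ 3) + 2)
          + (((L : ℝ) - r) - a) * ((2 * (t / (2 * π)) * r / (h * a) ^ 3)
              * (6 * (t / (2 * π)) * r / (h ^ 4 * (a : ℝ) ^ 4))) ^ (1 / 5 : ℝ))
      ≤ 3 * (h * Real.sqrt h * U ^ 90 / (Real.sqrt 2 * V ^ 60))
          * (1 + (yangA η (h ^ 13) 5 * (h ^ 13) ^ (1 / 8 : ℝ) * ((2 * (h - 1)) * V ^ 120 / U ^ 120)
              * ((105 / 16 / h ^ 2) ^ (1 / 30 : ℝ) * U ^ 18 / V ^ 16)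
            + yangB η 5 * ((2 * (h - 1)) ^ (7 / 8 : ℝ) * V ^ 105 / U ^ 105)
              * (((105 / 16 / h ^ 2) ^ (1 / 30 : ℝ))⁻¹ * V ^ 16 / U ^ 18)))
        + 50 * (h ^ 4) ^ 2 * (h * Real.sqrt h * U ^ 90 / (Real.sqrt 2 * V ^ 60)
          + (Real.log 2 + 3 + 3 * (((h - 1) / h ^ 3) ^ (1 / 3 : ℝ) * V ^ 40 / U ^ 40))
          + ((h - 1) * U ^ 60) * ((12 / h ^ 7) ^ (1 / 5 : ℝ) * V ^ 48 / U ^ 84)) := by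
        rw [one_div, hisq]
        exact add_le_add (mul_le_mul_of_nonneg_left (add_le_add le_rfl hY) (by positivity))
          (mul_le_mul_of_nonneg_left (add_le_add (add_le_add le_rfl hlog) hNE) (by positivity))
    _ = C₀ * (U ^ 90 / V ^ 60) + C₁ * (V ^ 44 / U ^ 12) + C₂ * (V ^ 61 / U ^ 33) + E₀
        + E₁ * (V ^ 40 / U ^ 40) + E₂ * (V ^ 48 / U ^ 24) := by
        rw [hC₀, hC₁, hC₂, hE₀, hE₁, hE₂]
        field_simp
        ring


end VdC
end Literature.NumberTheory.LFunctions
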